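import Literature.NumberTheory.EllipticCurves.ZpExtensionGaloisTwistSelmerStructure
import Literature.NumberTheory.EllipticCurves.ZpExtensionGaloisTwistUnramifiedProofs
import Literature.NumberTheory.EllipticCurves.ZpExtensionGaloisTwistWeilDual
import Literature.NumberTheory.EllipticCurves.WeilPairingProofs
import Literature.NumberTheory.GaloisCohomology.PoitouTateSelmerCountProofs
import Summits.BirchSwinnertonDyer.Rank1Residual.X11b.LocalPrimaryCohomologyEP
import Summits.BirchSwinnertonDyer.Rank1Residual.X11b.WeilTransport
import Summits.BirchSwinnertonDyer.Rank1Residual.GaloisImage.SelmerGroupFinite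
import Summits.BirchSwinnertonDyer.BirchSwinnertonDyer.Theorems.ThetaPartnerAtTwoSignedControlAtTwoRelaxedKummerCount
import HarnessLib

/-!
# THE RELAXED TWISTED COUNT over a number field, from Poitou–Tate for Selmer structures:
# `p^{2k} ≤ #H¹_rel(K, E[p^k](χ_u)) · #H¹_rel(K, E[p^k](χ_{u'}))` for `u u' ≡ 1 (mod p^k)`

Route `ThetaPartnerAtTwo` (TP2), crux K4 `SignedControlAtTwo` (stmt-BirchSwinnertonDyer-20309), line `eulerchar` v9
(stub `stub_pubGreenbergI1Two` = Cassels ∧ Prop 4.12 ∧ (I1)); width seat `bsd-wall-tp2-p3-w2` g4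
(`--supports stmt-BirchSwinnertonDyer-20309`, helper). TWIST ROAD (lead's architectural steer 2026-08-28T03:18Z/03:27Z):
what K4 needs from (I1) is only «the Pontryagin dual `Y` of `H = H¹(K_Σ/K_∞, E[p^∞])` is not `Λ`-torsion», and
Greenberg's own road to it (LNM 1716, §4 pp. 115–117, 123–124: Shapiro + the twists `A_s = E[p^∞] ⊗ κ^s`) is
LEVEL-`K`: no layers `K_n`. This file is its global-duality half, the twisted analogue of
`…SignedControlAtTwoRelaxedKummerCount`: a LOWER BOUND for the relaxed (= «`H¹(K_Σ/K, ·)`») cohomology of the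
finite twisted modules `M_u = E[p^k](χ_u)` (`W.twistedTorsionGaloisModule p κ k u hu`, `χ_u(σ) = u^{κ σ}`,
`u ≡ 1 mod p`), from the tree's canonical fact `GaloisCohomology.poitouTate_selmerStructure_duality K` ALONE.

## What is proved (theorems only; `K : Type` any number field, `E = W` elliptic, `p` prime, `κ` a `ℤ_p`-extension)

* `prime_pow_le_natCard_galoisCohomology_toLocal` — **`p^{2k} ≤ #H¹(K_v, M)`** for a finite discrete module of order
  `p^{2k}` at `v ∋ p`: Tate's local Euler characteristic `#H¹ = #H⁰·#H²·#(𝓞_v/#M)` (tree THEOREM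
  `localEulerPoincare_adicCompletionEP`, Milne I 2.8) and `p^{2k} ≤ #(𝓞_v/p^{2k})` (Part A).
* `prime_pow_le_natCard_selmerGroup_twisted_mul` — **`p^{2k} ≤ #H¹_𝓖(K, M_u) · #H¹_𝓖(K, M_{u'})`** for `k ≥ 1`,
  integers `u, u' ≡ 1 (mod p)` with `u u' ≡ 1 (mod p^k)`, `S₀` a finite set of places with good reduction outside
  `S₀ ∪ {v ∣ p}`, a place `v₀ ∋ p`, and `𝓖 = W.twistedRelaxedSelmerStructure p S₀ κ k · ·` (everything at
  `∞ ∪ S₀ ∪ {v ∣ p}`, unramified elsewhere: «`H¹(K_Σ/K, M)`»). Proof: Milne I 4.10 counting form (tree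
  `natCard_selmerQuotient_mul_of_poitouTate`) for the pair `𝓕 ≤ 𝓖`, `𝓕 = 𝓖` made STRICT (`⊥`) at the places above
  `p` (both `IsUnramifiedOutside (twistedDescentPlaces p S₀)`, `M_u` unramified off it by
  `natCast_pow_not_mem_and_isUnramifiedAt_twistedTorsionGaloisModule`): the local products cancel except above `p`,
  leaving `#(H¹_𝓖/H¹_𝓕)·#(H¹_{𝓕*}/H¹_{𝓖*}) = ∏_{v∣p} #H¹(K_v, M_u) ≥ #H¹(K_{v₀}, M_u) ≥ p^{2k}`; then
  `#(H¹_𝓖/H¹_𝓕) ≤ #H¹_𝓖(K, M_u)` and **`#(H¹_{𝓕*}/H¹_{𝓖*}) ≤ #H¹_{𝓕*}(K, M_u^D) ≤ #H¹_𝓖(K, M_{u'})`**: the inverse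
  twisted Weil transport `H¹(w⁻¹)` (`twistedWeilDualInv`, `M_u^D ≅ M_{u'}` — Greenberg's «`M^* = A_{−s}`», tree
  `ZpExtensionGaloisTwistWeilDual`) is injective and carries the dual Selmer group of `𝓕` into `H¹_𝓖(K, M_{u'})`:
  on `∞ ∪ S₀ ∪ {v ∣ p}` the target condition is everything, and off it `(H¹_ur)^* = H¹_ur` (conjunct
  `UnramifiedOrthogonal` of the fact, Milne I 2.6) is carried to `H¹_ur` (`map_mem_unramifiedSubgroup`). Both
  relaxed groups are finite (`finite_selmerGroup_of_isUnramifiedOutside`, Silverman X.4.3 / VIII.1.6 in the tree).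
  NO Kummer structure, NO archimedean analysis (at `∞` both structures are everything), NO global Euler
  characteristic.

Sequel (`…TwistNotTorsion`): restriction to `K_∞` (`twistedTorsionToH1`, injective when `E(K)[p] = 0`) puts these
classes in the `conj_γ`-eigenspaces `{φ = u}` / `{u·φ = id}` of `H`, whose finiteness for all but finitely many `u` is
forced by `Λ`-torsion of `Y` (`IwasawaAlgebra.finite_setOf_not_finite_quotient_X_sub_C`) — contradiction: `Y` is not
`Λ`-torsion.

HONEST FRAMING: THEOREMS ONLY (no definition, no named fact, no `sorry`), CONDITIONAL on the named Poitou–Tate fact as a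
hypothesis; closes nothing by itself; BSD is not proved by any of this.

References: [cite: GreenbergLNM1716, §4 pp. 107, 115–117, 122–124] [cite: MilneADT2006, Ch. I, Thm. 2.6, Thm. 2.8,
Thm. 4.10] [cite: Howard2004HeegnerKolyvagin, Def. 2.1.10, Thm. 2.1.11 (arXiv:1202.6340 p. 6)].
-/

set_option linter.dupNamespace false

noncomputable section
open scoped Classical
open CategoryTheory Field NumberField IsDedekindDomain Function
open Literature.NumberTheory.EllipticCurves
open Literature.NumberTheory.GaloisRepresentations
open Literature.NumberTheory.GaloisRepresentations.DiscreteGaloisModule (SelmerStructure tateDual unramifiedSubgroup)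
open Literature.NumberTheory.GaloisCohomology
open scoped ContRepresentation
namespace Summit.BirchSwinnertonDyer.BirchSwinnertonDyer.Theorems.SignedEC.RelaxedTwistCount

open Summit.BirchSwinnertonDyer.Rank1Residual.X11b.LocBridge Summit.BirchSwinnertonDyer.Rank1Residual.X11b.Levels
  Summit.BirchSwinnertonDyer.Rank1Residual.GaloisImage.SelmerFinite WeierstrassCurve

variable {K : Type} [Field K] [NumberField K] (W : WeierstrassCurve K) [W.IsElliptic] (p : ℕ) [Fact p.Prime]
  (κ : ZpExtension K p) (S₀ : Finset (HeightOneSpectrum (𝓞 K)))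

/-- **Tate's local Euler characteristic, lower bound: `p^{2k} ≤ #H¹(K_v, M)` for a finite discrete
`Γ_K`-module `M` of order `p^{2k}` at a place `v ∋ p`** (`#H¹ = #H⁰ · #H² · #(𝓞_v/#M)`, tree theorem
`localEulerPoincare_adicCompletionEP`, and `p^{2k} ≤ #(𝓞_v/p^{2k})`). [cite: MilneADT2006, I §2 Thm 2.8 (p. 31)] -/
theorem prime_pow_le_natCard_galoisCohomology_toLocal {M : Type} [AddCommGroup M] [TopologicalSpace M]
    [DiscreteTopology M] [Finite M] (ρ : DiscreteGaloisModule K M) (k : ℕ) (hM : Nat.card M = p ^ (2 * k))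
    {v : HeightOneSpectrum (𝓞 K)} (hv : ((p : ℕ) : 𝓞 K) ∈ v.asIdeal) :
    p ^ (2 * k) ≤ Nat.card (galoisCohomology (ρ.toLocal (Sum.inr v)) 1) := by
  obtain ⟨h1, h2, hEP⟩ := localEulerPoincare_adicCompletionEP K v (ρ.toLocal (Sum.inr v))
  haveI : Finite (galoisCohomology (ρ.toLocal (Sum.inr v)) 1) := h1
  haveI : Finite (galoisCohomology (ρ.toLocal (Sum.inr v)) 2) := h2
  rw [hM] at hEP
  have hq : p ^ (2 * k) ≤ Nat.card (v.adicCompletionIntegers K ⧸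
      Ideal.span {((p ^ (2 * k) : ℕ) : v.adicCompletionIntegers K)}) :=
    RelaxedKummerCount.prime_pow_le_natCard_quot_adicCompletionIntegers p hv (2 * k)
  have hi : 0 < Nat.card (ρ.toLocal (Sum.inr v)).toTopRep.ρ.invariants := Nat.card_pos
  have h2' : 0 < Nat.card (galoisCohomology (ρ.toLocal (Sum.inr v)) 2) := Nat.card_pos
  refine le_trans (le_trans hq (Nat.le_mul_of_pos_left _ (Nat.mul_pos hi h2'))) ?_
  exact le_of_eq hEP

/-- **THE RELAXED TWISTED COUNT: `p^{2k} ≤ #H¹_𝓖(K, E[p^k](χ_u)) · #H¹_𝓖(K, E[p^k](χ_{u'}))`** (`u u' ≡ 1 mod p^k`,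
`𝓖` = everything at `∞ ∪ S₀ ∪ {v ∣ p}`, unramified elsewhere), GIVEN `poitouTate_selmerStructure_duality K`, good
reduction off `S₀ ∪ {v ∣ p}` and a place `v₀ ∋ p`. Milne I 4.10 counting form for `𝓕 ≤ 𝓖` (`𝓕` strict above `p`),
Tate's count at `v₀`, `UnramifiedOrthogonal` off `∞ ∪ S₀ ∪ {v ∣ p}`, and the injective inverse twisted Weil
transport `H¹_{𝓕*}(K, M_u^D) ↪ H¹_𝓖(K, M_{u'})`. See the module docstring.
[cite: GreenbergLNM1716, §4 pp. 122–124] [cite: MilneADT2006, Ch. I, Thm. 4.10, Thm. 2.6, Thm. 2.8] -/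
theorem prime_pow_le_natCard_selmerGroup_twisted_mul (hPT : poitouTate_selmerStructure_duality K)
    (hgood : ∀ v : HeightOneSpectrum (𝓞 K), v ∉ S₀ → ((p : ℕ) : 𝓞 K) ∉ v.asIdeal → W.HasGoodReductionAt v)
    {v₀ : HeightOneSpectrum (𝓞 K)} (hv₀ : ((p : ℕ) : 𝓞 K) ∈ v₀.asIdeal)
    {k : ℕ} (hk : 0 < k) {u u' : ℤ} (hu : (p : ℤ) ∣ u - 1) (hu' : (p : ℤ) ∣ u' - 1)
    (huu' : ((p : ℤ) ^ k) ∣ u * u' - 1) :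
    p ^ (2 * k) ≤
      Nat.card (W.twistedRelaxedSelmerStructure p S₀ κ k u hu).selmerGroup *
        Nat.card (W.twistedRelaxedSelmerStructure p S₀ κ k u' hu').selmerGroup := by
  classical
  have hprime : p.Prime := Fact.out
  haveI : NeZero (p ^ k) := ⟨pow_ne_zero k hprime.ne_zero⟩
  haveI hfinM : Finite (W.geomTorsion ((p ^ k : ℕ) : ℤ)) := finite_geomTorsion_of_neZero W _
  haveI : CompactSpace (absoluteGaloisGroup K) := absoluteGaloisGroup_compactSpace K
  have hp2 : 2 ≤ p ^ k := le_trans hprime.two_le (Nat.le_self_pow hk.ne' p)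
  have hchar : ((p ^ k : ℕ) : K) ≠ 0 := Nat.cast_ne_zero.mpr (pow_ne_zero _ hprime.ne_zero)
  obtain ⟨e, hμ, hadd₁, hadd₂, halt, hnondeg, hgal⟩ := W.exists_weilPairing_holds (p ^ k) hp2 hchar
  obtain ⟨inv, hperf, hsum, hunr, hcompl⟩ := hPT (p ^ k)
  -- notation
  set ρ := W.twistedTorsionGaloisModule p κ k u hu with hρ
  set ρ' := W.twistedTorsionGaloisModule p κ k u' hu' with hρ'
  set T : Finset (Place K) := twistedDescentPlaces (K := K) p S₀ with hT
  set 𝓖 : SelmerStructure ρ := W.twistedRelaxedSelmerStructure p S₀ κ k u hu with h𝓖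
  set 𝓖' : SelmerStructure ρ' := W.twistedRelaxedSelmerStructure p S₀ κ k u' hu' with h𝓖'
  -- the places above `p`, and `𝓕 = 𝓖` made strict there
  set Pl : Finset (Place K) := (placesAbove (K := K) p).map ⟨Sum.inr, Sum.inr_injective⟩ with hPl
  have hPl : ∀ v : Place K, v ∈ Pl ↔ ∃ v' : HeightOneSpectrum (𝓞 K), ((p : ℕ) : 𝓞 K) ∈ v'.asIdeal ∧ v = Sum.inr v' := by
    intro v
    rw [hPl, Finset.mem_map]
    constructor
    · rintro ⟨v', hv', rfl⟩
      exact ⟨v', (mem_placesAbove_iff p v').mp hv', rfl⟩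
    · rintro ⟨v', hv', rfl⟩
      exact ⟨v', (mem_placesAbove_iff p v').mpr hv', rfl⟩
  have hPlT : Pl ⊆ T := by
    intro v hv
    obtain ⟨v', hv', rfl⟩ := (hPl v).mp hv
    exact (inr_mem_twistedDescentPlaces_iff p S₀ v').mpr (Or.inr hv')
  let 𝓕 : SelmerStructure ρ := fun v ↦ if v ∈ Pl then ⊥ else 𝓖 v
  have h𝓕_of_mem : ∀ v ∈ Pl, 𝓕 v = ⊥ := fun v hv ↦ by simp only [𝓕, if_pos hv]
  have h𝓕_of_not_mem : ∀ v ∉ Pl, 𝓕 v = 𝓖 v := fun v hv ↦ by simp only [𝓕, if_neg hv]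
  have hle : 𝓕 ≤ 𝓖 := by
    intro v
    by_cases hv : v ∈ Pl
    · rw [h𝓕_of_mem v hv]; exact bot_le
    · rw [h𝓕_of_not_mem v hv]
  have hinl_not : ∀ w : InfinitePlace K, (Sum.inl w : Place K) ∉ Pl := fun w hw ↦ by
    obtain ⟨v', -, h⟩ := (hPl _).mp hw
    exact Sum.inl_ne_inr h
  have h𝓖unr : 𝓖.IsUnramifiedOutside T := W.isUnramifiedOutside_twistedRelaxedSelmerStructure p S₀ κ k u hu
  have h𝓕unr : 𝓕.IsUnramifiedOutside T := by
    refine ⟨h𝓖unr.1, fun v hv ↦ ?_⟩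
    rw [h𝓕_of_not_mem _ (fun h ↦ hv (hPlT h))]
    exact h𝓖unr.2 v hv
  have hinfeq : ∀ w : InfinitePlace K, 𝓕 (Sum.inl w) = 𝓖 (Sum.inl w) := fun w ↦ h𝓕_of_not_mem _ (hinl_not w)
  have hMn : ∀ m : W.geomTorsion ((p ^ k : ℕ) : ℤ), (p ^ k) • m = 0 := fun m ↦ AddSubgroup.torsionBy.nsmul m
  have hTout : ∀ v : HeightOneSpectrum (𝓞 K), (Sum.inr v : Place K) ∉ T →
      ((p ^ k : ℕ) : 𝓞 K) ∉ v.asIdeal ∧ GaloisRep.IsUnramifiedAt v ρ := by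
    intro v hv
    rw [hT, not_mem_twistedDescentPlaces_iff] at hv
    exact W.natCast_pow_not_mem_and_isUnramifiedAt_twistedTorsionGaloisModule p κ k u hu
      (S₀ := (↑S₀ : Set (HeightOneSpectrum (𝓞 K)))) (fun v hv hpv ↦ hgood v hv hpv) hv.1 hv.2
  set Sf : Finset (HeightOneSpectrum (𝓞 K)) := T.preimage Sum.inr (Sum.inr_injective.injOn) with hSf
  have hSfmem : ∀ v, v ∈ Sf ↔ (Sum.inr v : Place K) ∈ T := fun v ↦ by rw [hSf, Finset.mem_preimage]
  -- Poitou–Tate, counting form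
  have key := natCard_selmerQuotient_mul_of_poitouTate hperf hsum hcompl ρ hMn T hTout hle h𝓕unr h𝓖unr hinfeq Sf
    hSfmem
  -- local finiteness
  haveI hfinloc : ∀ v : HeightOneSpectrum (𝓞 K), Finite (galoisCohomology (ρ.toLocal (Sum.inr v)) 1) := fun v ↦ by
    haveI : CharZero (v.adicCompletion K) := charZero_adicCompletion v
    change Finite (galoisCohomology (GaloisRep.restrictField (v.adicCompletion K) ρ) 1)
    exact finite_galoisCohomology_one_of_isNonarchimedeanLocalField _
  -- split the products at the places above `p`
  set P : Finset (HeightOneSpectrum (𝓞 K)) := Sf.filter (fun v ↦ ((p : ℕ) : 𝓞 K) ∈ v.asIdeal) with hP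
  have hv₀P : v₀ ∈ P := by
    rw [hP, Finset.mem_filter, hSfmem]
    exact ⟨(inr_mem_twistedDescentPlaces_iff p S₀ v₀).mpr (Or.inr hv₀), hv₀⟩
  have h𝓕P : ∀ v ∈ P, Nat.card (𝓕 (Sum.inr v)) = 1 := by
    intro v hv
    rw [h𝓕_of_mem _ ((hPl _).mpr ⟨v, (Finset.mem_filter.mp hv).2, rfl⟩)]
    exact Nat.card_unique
  have h𝓕notP : ∀ v ∈ Sf.filter (fun v ↦ ¬ ((p : ℕ) : 𝓞 K) ∈ v.asIdeal), 𝓕 (Sum.inr v) = 𝓖 (Sum.inr v) := by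
    intro v hv
    refine h𝓕_of_not_mem _ (fun h ↦ (Finset.mem_filter.mp hv).2 ?_)
    obtain ⟨v', hv', hvv'⟩ := (hPl _).mp h
    rwa [Sum.inr_injective hvv']
  have h𝓖P : ∀ v ∈ P, Nat.card (𝓖 (Sum.inr v)) = Nat.card (galoisCohomology (ρ.toLocal (Sum.inr v)) 1) := by
    intro v hv
    rw [h𝓖, W.twistedRelaxedSelmerStructure_inr_of_mem_asIdeal p S₀ κ k u hu (Finset.mem_filter.mp hv).2,
      AddSubgroup.card_top]
  set Q := ∏ v ∈ Sf.filter (fun v ↦ ¬ ((p : ℕ) : 𝓞 K) ∈ v.asIdeal), Nat.card (𝓖 (Sum.inr v)) with hQ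
  set R := ∏ v ∈ P, Nat.card (galoisCohomology (ρ.toLocal (Sum.inr v)) 1) with hR
  have hQpos : 0 < Q := Finset.prod_pos fun v _ ↦ Nat.card_pos
  have hprodF : ∏ v ∈ Sf, Nat.card (𝓕 (Sum.inr v)) = Q := by
    rw [← Finset.prod_filter_mul_prod_filter_not Sf (fun v ↦ ((p : ℕ) : 𝓞 K) ∈ v.asIdeal),
      Finset.prod_eq_one h𝓕P, one_mul]
    exact Finset.prod_congr rfl fun v hv ↦ by rw [h𝓕notP v hv]
  have hprodG : ∏ v ∈ Sf, Nat.card (𝓖 (Sum.inr v)) = R * Q := by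
    rw [← Finset.prod_filter_mul_prod_filter_not Sf (fun v ↦ ((p : ℕ) : 𝓞 K) ∈ v.asIdeal)]
    exact congrArg (· * Q) (Finset.prod_congr rfl fun v hv ↦ h𝓖P v hv)
  -- `p^{2k} ≤ R`
  have hR : p ^ (2 * k) ≤ R := by
    have hcard : Nat.card (W.geomTorsion ((p ^ k : ℕ) : ℤ)) = p ^ (2 * k) := by
      rw [WeierstrassCurve.natCard_geomTorsion W (n := ((p ^ k : ℕ) : ℤ))
        (by exact_mod_cast NeZero.ne (p ^ k)), Int.natAbs_natCast]
      ring
    have hsingle := Finset.single_le_prod' (s := P)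
      (f := fun v ↦ Nat.card (galoisCohomology (ρ.toLocal (Sum.inr v)) 1))
      (fun v _ ↦ Nat.one_le_iff_ne_zero.mpr Nat.card_pos.ne') hv₀P
    exact (prime_pow_le_natCard_galoisCohomology_toLocal p ρ k hcard hv₀).trans hsingle
  -- the two indices
  set a := Nat.card (𝓖.selmerGroup ⧸ (𝓕.selmerGroup).addSubgroupOf 𝓖.selmerGroup) with ha
  set b := Nat.card ((inv.dualSelmerStructure ρ 𝓕).selmerGroup ⧸
    ((inv.dualSelmerStructure ρ 𝓖).selmerGroup).addSubgroupOf (inv.dualSelmerStructure ρ 𝓕).selmerGroup) with hb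
  have hab : a * b = R := by
    rw [hprodF, hprodG] at key
    have key' : a * b * Q = R * Q := by rw [← key]
    exact Nat.eq_of_mul_eq_mul_right hQpos key'
  -- finiteness of the relaxed Selmer groups
  haveI hfinG : Finite 𝓖.selmerGroup :=
    finite_selmerGroup_of_isUnramifiedOutside ρ (fun v hv ↦ (hTout v hv).2) h𝓖unr
  have hTout' : ∀ v : HeightOneSpectrum (𝓞 K), (Sum.inr v : Place K) ∉ T → GaloisRep.IsUnramifiedAt v ρ' := by
    intro v hv
    rw [hT, not_mem_twistedDescentPlaces_iff] at hv
    exact (W.natCast_pow_not_mem_and_isUnramifiedAt_twistedTorsionGaloisModule p κ k u' hu'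
      (S₀ := (↑S₀ : Set (HeightOneSpectrum (𝓞 K)))) (fun v hv hpv ↦ hgood v hv hpv) hv.1 hv.2).2
  haveI hfinG' : Finite 𝓖'.selmerGroup :=
    finite_selmerGroup_of_isUnramifiedOutside ρ' hTout' (W.isUnramifiedOutside_twistedRelaxedSelmerStructure p S₀ κ k u' hu')
  -- the dual Selmer group of `𝓕` injects into `H¹_{𝓖'}(K, E[p^k](χ_{u'}))` by the inverse twisted Weil transport
  have hto : ∀ y ∈ (inv.dualSelmerStructure ρ 𝓕).selmerGroup,
      galoisCohomology.map (W.twistedWeilDualInv p κ k hu hu' huu' e hμ hadd₁ hadd₂ hgal hnondeg) 1 y ∈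
        𝓖'.selmerGroup := by
    intro y hy
    rw [SelmerStructure.mem_selmerGroup_iff] at hy ⊢
    intro v
    rw [show galoisCohomology.localization ρ' v 1
        (galoisCohomology.map (W.twistedWeilDualInv p κ k hu hu' huu' e hμ hadd₁ hadd₂ hgal hnondeg) 1 y) =
        galoisCohomology.map ((W.twistedWeilDualInv p κ k hu hu' huu' e hμ hadd₁ hadd₂ hgal hnondeg).restrictField
          (Place.Completion v)) 1 (galoisCohomology.localization (ρ.tateDual (p ^ k)) v 1 y) from
      galoisCohomology.res_map_one (Place.Completion v) _ y]
    by_cases hvT : v ∈ T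
    · rw [h𝓖', W.twistedRelaxedSelmerStructure_eq_top_of_mem p S₀ κ k u' hu' hvT]
      exact AddSubgroup.mem_top _
    · cases v with
      | inl w => exact absurd (inl_mem_twistedDescentPlaces p S₀ w) hvT
      | inr v =>
        have hv := (not_mem_twistedDescentPlaces_iff p S₀ v).mp hvT
        have hyv := hy (Sum.inr v)
        rw [LocalInvariants.dualSelmerStructure_apply, h𝓕_of_not_mem _ (fun h ↦ hvT (hPlT h)), h𝓖,
          W.twistedRelaxedSelmerStructure_inr_of_not_mem p S₀ κ k u hu hv.1 hv.2,
          (hunr ρ hMn v (hTout v hvT).1 (hTout v hvT).2).1] at hyv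
        rw [h𝓖', W.twistedRelaxedSelmerStructure_inr_of_not_mem p S₀ κ k u' hu' hv.1 hv.2]
        exact map_mem_unramifiedSubgroup _ hyv
  set φ : (inv.dualSelmerStructure ρ 𝓕).selmerGroup → 𝓖'.selmerGroup := fun y ↦
    ⟨galoisCohomology.map (W.twistedWeilDualInv p κ k hu hu' huu' e hμ hadd₁ hadd₂ hgal hnondeg) 1 y.1, hto y.1 y.2⟩
    with hφ
  have hφinj : Injective φ := by
    intro y y' h
    apply Subtype.ext
    have h1 : (φ y).1 = (φ y').1 := congrArg Subtype.val h
    have h2 := congrArg (galoisCohomology.map (W.twistedWeilDual p κ k hu hu' huu' e hμ hadd₁ hadd₂ hgal) 1) h1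
    rwa [W.map_twistedWeilDual_map_inv, W.map_twistedWeilDual_map_inv] at h2
  haveI hfinFd : Finite (inv.dualSelmerStructure ρ 𝓕).selmerGroup := Finite.of_injective φ hφinj
  have hb_le : b ≤ Nat.card 𝓖'.selmerGroup :=
    (Nat.card_le_card_of_surjective _ (QuotientAddGroup.mk_surjective)).trans
      (Nat.card_le_card_of_injective φ hφinj)
  have ha_le : a ≤ Nat.card 𝓖.selmerGroup := Nat.card_le_card_of_surjective _ (QuotientAddGroup.mk_surjective)
  calc p ^ (2 * k) ≤ R := hR
    _ = a * b := hab.symm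
    _ ≤ Nat.card 𝓖.selmerGroup * Nat.card 𝓖'.selmerGroup := Nat.mul_le_mul ha_le hb_le

end Summit.BirchSwinnertonDyer.BirchSwinnertonDyer.Theorems.SignedEC.RelaxedTwistCount

end
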